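import Summits.HodgeConjecture.CorCM.Census.CentralSquaresTieForcing
import Summits.HodgeConjecture.CorCM.Census.CentralSquaresCompanion

/-!
# The square-central class, XVI: the TIE CORNER DICHOTOMY at `m = 2` — `[X] ≡ NF_{T₀}` or `[X] ≡ NF_{T̄₁}`

COR-CM (cell `pub-hodgecm2`), count-neutral kernel combinatorics by the binder seat b09 (gen 45; lane SQUARE-CENTRAL CLASS, part XVI), on parts XIV–XV (corner
normal forms, strict triples, forcing), V (`cover_frame`, `unique_frame`, `card_sdiff_frame`, `sdiff_eq_of_dev`), VI (`base_cases_exchange`, `card_frame`) and VII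
(`companion_base`, `companion_card`), BY NAME.  Theorems only; no `decide`, no certificate, no named fact, no `sorry`.  HONEST FRAMING: `HC_CM` is NOT proved,
here or anywhere in the tree; nothing here is a period or a headline.

`m = 2`.  At the shape-A tie corner `X = ⟨p, q, q'⟩` (`p ∈ 𝓗`, `q ≠ q' ∈ T₀ ∩ T₁`) of the designated pair face, a strict lowering cover feeding `L` gives EITHER the
star normal form toward `T₀` OR the one toward `T̄₁ = T₀·(cQ)⁻¹` (`tie_corner_dichotomy_shapeA`): the coverʼs strict face at `X` points to one of the two nearest base
changes (part XV), forcing pins its places to the two same-side deviation places in the corresponding frame (part XV in the frame `(T̄₁; T₀)` for the second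
case, transported by parts V–VII), and part XIV delivers the normal form.  This is the uncontrolled direction `ε_i` of the design note (`CENTRAL-SQUARES.md` §4).

## References
* [Pohlmann1968] H. Pohlmann, Algebraic cycles on abelian varieties of complex multiplication type, Ann. of Math. 88 (1968), Thm 1.
* [Milne1999] J. S. Milne, Lefschetz motives and the Tate conjecture, Compositio Math. 117 (1999), Prop. 2.1, p. 54.
-/

namespace Summit.HodgeConjecture.CorCM.Census.CentralSquares

open Finset
open scoped symmDiff
open Summit.HodgeConjecture.CorCM.Prior.AllgGroup.RfwfAllgGroup
open Summit.HodgeConjecture.CorCM.Census.BlockParity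
open Summit.HodgeConjecture.CorCM.Census.Coinvariant
open Summit.HodgeConjecture.CorCM.Census.TwistGeneration
open Summit.HodgeConjecture.CorCM.Census.BaseBlock
open Summit.HodgeConjecture.CorCM.Census.CoverClosure

noncomputable section

variable {G : Type*} [Group G] [Fintype G] [DecidableEq G] (c : G)

/-! ## §1 Membership in the complement type and the deviation set seen from `T̄₁` -/

/-- `x ∈ T̄₁ ↔ x ∉ T₁` (central `c`). [folklore] -/
theorem mem_compl_type_iff (hcen : ∀ x : G, x * c = c * x) (T₁ : CMF G c) (x : G) : x ∈ (rt c c T₁).1 ↔ x ∉ T₁.1 := by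
  rw [rt_self_val c hcen, mem_sdiff]; simp only [mem_univ, true_and]

/-- **The shape-A corner seen from `T̄₁`.**  If `D(X) = {p, q, q'}` with `p ∈ 𝓗` and `q ≠ q' ∈ T₀ ∩ T₁`, and `{b, b'} = (T₀ ∩ T₁) ∖ {q, q'}`, then the
deviation set of `X` from `T̄₁` is `{p, c·b, c·b'}`. [folklore] -/
theorem dev_compl_shapeA (hc2 : c * c = 1) (hcen : ∀ x : G, x * c = c * x) (T₀ T₁ : CMF G c) {p q q' : G}
    (hp : p ∈ T₀.1 \ T₁.1) (hq : q ∈ T₀.1 ∩ T₁.1) (hq' : q' ∈ T₀.1 ∩ T₁.1) (X : CMF G c) (hX : T₀.1 \ X.1 = {p, q, q'})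
    {b b' : G} (hbb : (T₀.1 ∩ T₁.1) \ {q, q'} = {b, b'}) :
    (rt c c T₁).1 \ X.1 = {p, c * b, c * b'} := by
  have hHc : T₀.1 \ (rt c c T₁).1 = T₀.1 ∩ T₁.1 := by
    rw [dev_compl c hcen T₀ T₁]; ext x; simp only [mem_sdiff, mem_inter, not_and, not_not]; tauto
  rw [sdiff_eq_of_dev c hc2 T₀ (rt c c T₁) X, hHc, hX]
  have h1 : ({p, q, q'} : Finset G) \ (T₀.1 ∩ T₁.1) = {p} := by
    ext x; simp only [mem_sdiff, mem_insert, mem_singleton]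
    constructor
    · rintro ⟨h | h | h, hx⟩
      · exact h
      · exact absurd (h ▸ hq) hx
      · exact absurd (h ▸ hq') hx
    · rintro rfl; exact ⟨Or.inl rfl, fun h => (mem_sdiff.mp hp).2 (mem_inter.mp h).2⟩
  have h2 : (T₀.1 ∩ T₁.1) \ ({p, q, q'} : Finset G) = (T₀.1 ∩ T₁.1) \ {q, q'} := by
    ext x; simp only [mem_sdiff, mem_insert, mem_singleton, not_or]
    constructor
    · rintro ⟨hx, -, h2, h3⟩; exact ⟨hx, h2, h3⟩
    · rintro ⟨hx, h2, h3⟩; exact ⟨hx, fun h => (mem_sdiff.mp hp).2 (h ▸ (mem_inter.mp hx).2), h2, h3⟩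
  rw [h1, h2, hbb, image_insert, image_singleton]
  ext x; simp only [mem_union, mem_singleton, mem_insert]

/-- **The shape-B corner seen from `T₁`.**  If `D(X) = {p, q, q'}` with `p ∈ T₀ ∩ T₁` and `q ≠ q' ∈ 𝓗`, and `{h, h'} = 𝓗 ∖ {q, q'}`, then the deviation set of
`X` from `T₁` is `{p, c·h, c·h'}`. [folklore] -/
theorem dev_frame_shapeB (hc2 : c * c = 1) (T₀ T₁ : CMF G c) {p q q' : G}
    (hp : p ∈ T₀.1 ∩ T₁.1) (hq : q ∈ T₀.1 \ T₁.1) (hq' : q' ∈ T₀.1 \ T₁.1) (X : CMF G c) (hX : T₀.1 \ X.1 = {p, q, q'})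
    {h h' : G} (hhh : (T₀.1 \ T₁.1) \ {q, q'} = {h, h'}) :
    T₁.1 \ X.1 = {p, c * h, c * h'} := by
  rw [sdiff_eq_of_dev c hc2 T₀ T₁ X, hX]
  have h1 : ({p, q, q'} : Finset G) \ (T₀.1 \ T₁.1) = {p} := by
    ext x; simp only [mem_sdiff, mem_insert, mem_singleton]
    constructor
    · rintro ⟨hx | hx | hx, hx'⟩
      · exact hx
      · exact absurd (hx ▸ hq) (fun h0 => hx' (mem_sdiff.mp h0))
      · exact absurd (hx ▸ hq') (fun h0 => hx' (mem_sdiff.mp h0))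
    · rintro rfl; exact ⟨Or.inl rfl, fun h0 => h0.2 (mem_inter.mp hp).2⟩
  have h2 : (T₀.1 \ T₁.1) \ ({p, q, q'} : Finset G) = (T₀.1 \ T₁.1) \ {q, q'} := by
    ext x; simp only [mem_sdiff, mem_insert, mem_singleton, not_or]
    constructor
    · rintro ⟨hx, -, h2, h3⟩; exact ⟨hx, h2, h3⟩
    · rintro ⟨hx, h2, h3⟩; exact ⟨hx, fun h0 => hx.2 (h0 ▸ (mem_inter.mp hp).2), h2, h3⟩
  rw [h1, h2, hhh, image_insert, image_singleton]
  ext x; simp only [mem_union, mem_singleton, mem_insert]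

section Frame

variable (hc2 : c * c = 1) (hcen : ∀ x : G, x * c = c * x) (T₀ T₁ : CMF G c)
variable (hbase : ∀ Q : G, rt c Q T₀ = T₀ ∨ rt c Q T₀ = rt c c T₀ ∨ rt c Q T₀ = T₁ ∨ rt c Q T₀ = rt c c T₁)
variable (m : ℕ) (hn : T₀.1.card = 4 * m) (hH : (T₀.1 \ T₁.1).card = 2 * m)
variable (Q : G) (hQ : rt c Q T₀ = T₁)
variable (L : Submodule ℤ (CMF G c →₀ ℤ))
variable (hcover : ∀ Ψ : CMF G c, 2 ≤ bpot c T₀ Ψ → ∃ Q₂ s s' : G, bpot c T₀ Ψ = ddist (rt c Q₂ T₀) Ψ ∧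
    s ∈ (rt c Q₂ T₀).1 \ Ψ.1 ∧ s' ∈ (rt c Q₂ T₀).1 \ Ψ.1 ∧ s ≠ s' ∧
    gface c hc2 Ψ s s' ∈ L ∧
    ((∃ Q₁ t t' : G, bpot c T₀ Ψ = ddist (rt c Q₁ T₀) Ψ ∧ t ∈ (rt c Q₁ T₀).1 \ Ψ.1 ∧ t' ∈ (rt c Q₁ T₀).1 \ Ψ.1 ∧ t ≠ t' ∧
        (∀ Q' : G, ddist (rt c Q' T₀) (oflipCM c hc2 t Ψ) = bpot c T₀ (oflipCM c hc2 t Ψ) → rt c Q' T₀ = rt c Q₁ T₀) ∧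
        (∀ Q' : G, ddist (rt c Q' T₀) (oflipCM c hc2 t' Ψ) = bpot c T₀ (oflipCM c hc2 t' Ψ) → rt c Q' T₀ = rt c Q₁ T₀) ∧
        (∀ Q' : G, ddist (rt c Q' T₀) (oflipCM c hc2 t (oflipCM c hc2 t' Ψ)) = bpot c T₀ (oflipCM c hc2 t (oflipCM c hc2 t' Ψ)) →
          rt c Q' T₀ = rt c Q₁ T₀)) →
      (∀ Q' : G, ddist (rt c Q' T₀) (oflipCM c hc2 s Ψ) = bpot c T₀ (oflipCM c hc2 s Ψ) → rt c Q' T₀ = rt c Q₂ T₀) ∧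
      (∀ Q' : G, ddist (rt c Q' T₀) (oflipCM c hc2 s' Ψ) = bpot c T₀ (oflipCM c hc2 s' Ψ) → rt c Q' T₀ = rt c Q₂ T₀) ∧
      (∀ Q' : G, ddist (rt c Q' T₀) (oflipCM c hc2 s (oflipCM c hc2 s' Ψ)) = bpot c T₀ (oflipCM c hc2 s (oflipCM c hc2 s' Ψ)) →
        rt c Q' T₀ = rt c Q₂ T₀)))

/-! ## §2 The dichotomy -/

include hcen hbase hn hH hQ hcover in
/-- **TIE CORNER DICHOTOMY, shape A, `m = 2`.**  For the corner `X = ⟨p, q, q'⟩` (`p ∈ 𝓗`, `q ≠ q' ∈ T₀ ∩ T₁`): `[X] − θ_{T₀}(typeSum [X]) ∈ L` or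
`[X] − θ_{T̄₁}(typeSum [X]) ∈ L`, for every strict lowering cover feeding `L`. [folklore] -/
theorem tie_corner_dichotomy_shapeA (hm : m = 2) {p q q' : G} (hp : p ∈ T₀.1 \ T₁.1) (hq : q ∈ T₀.1 ∩ T₁.1)
    (hq' : q' ∈ T₀.1 ∩ T₁.1) (hqq' : q ≠ q') (X : CMF G c) (hX : T₀.1 \ X.1 = {p, q, q'}) :
    Finsupp.single X 1 - thetaG c hc2 T₀ (typeSum G c (Finsupp.single X 1)) ∈ L ∨
      Finsupp.single X 1 - thetaG c hc2 (rt c c T₁) (typeSum G c (Finsupp.single X 1)) ∈ L := by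
  have hm2 : 2 ≤ m := by omega
  have hp0 : p ∈ T₀.1 := (mem_sdiff.mp hp).1
  have hp1 : p ∉ T₁.1 := (mem_sdiff.mp hp).2
  have hq0 : q ∈ T₀.1 := (mem_inter.mp hq).1
  have hq0' : q' ∈ T₀.1 := (mem_inter.mp hq').1
  have hpq0 : p ≠ q := fun h => hp1 (h ▸ (mem_inter.mp hq).2)
  have hpq0' : p ≠ q' := fun h => hp1 (h ▸ (mem_inter.mp hq').2)
  have hpq : p ∈ T₁.1 ↔ q ∉ T₁.1 := iff_of_false hp1 (not_not.mpr (mem_inter.mp hq).2)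
  have hpq' : p ∈ T₁.1 ↔ q' ∉ T₁.1 := iff_of_false hp1 (not_not.mpr (mem_inter.mp hq').2)
  obtain ⟨hbp, hnear⟩ := nearest_shapeA c hc2 hcen T₀ T₁ hbase m hn hH hm2 hp hq hq' hqq' X hX
  obtain ⟨k0, kq, kq', -, ku1, ku2, ku3⟩ :=
    strict_triple_tie_corner c hc2 hcen T₀ T₁ hbase m hn hH hm2 hp0 hq0 hq0' hqq' hpq hpq' X hX hbp
  obtain ⟨Q₂, s, s', hQ₂, hs, hs', hss', hmem, hstr⟩ := hcover X (by rw [hbp]; omega)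
  obtain ⟨hu1, hu2, -⟩ := hstr ⟨1, q, q', k0, kq, kq', hqq', ku1, ku2, ku3⟩
  have hB : rt c (c * Q) T₀ = rt c c T₁ := by rw [rt_mul, hQ]
  rcases hnear Q₂ hQ₂.symm with h0 | h1
  · -- the cover face points to `T₀`: its places are `{q, q'}`
    left
    rw [h0] at hs hs' hu1 hu2
    have hu1' : ∀ Q' : G, ddist (rt c Q' T₀) (oflipCM c hc2 s X) = bpot c T₀ (oflipCM c hc2 s X) → rt c Q' T₀ = rt c (1 : G) T₀ :=
      fun Q' h => by rw [rt_one]; exact hu1 Q' h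
    have hu2' : ∀ Q' : G, ddist (rt c Q' T₀) (oflipCM c hc2 s' X) = bpot c T₀ (oflipCM c hc2 s' X) → rt c Q' T₀ = rt c (1 : G) T₀ :=
      fun Q' h => by rw [rt_one]; exact hu2 Q' h
    have hsp : s ≠ p := strict_place_ne_shapeA c hc2 hcen T₀ T₁ hbase m hn hH hm hp hq hq' hqq' X hX (c * Q) hB hu1'
    have hs'p : s' ≠ p := strict_place_ne_shapeA c hc2 hcen T₀ T₁ hbase m hn hH hm hp hq hq' hqq' X hX (c * Q) hB hu2'
    have hsin : s = q ∨ s = q' := by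
      have h := hs; rw [hX, mem_insert, mem_insert, mem_singleton] at h
      rcases h with h | h | h
      · exact absurd h hsp
      · exact Or.inl h
      · exact Or.inr h
    have hs'in : s' = q ∨ s' = q' := by
      have h := hs'; rw [hX, mem_insert, mem_insert, mem_singleton] at h
      rcases h with h | h | h
      · exact absurd h hs'p
      · exact Or.inl h
      · exact Or.inr h
    have hsI : s ∈ T₀.1 ∩ T₁.1 := by rcases hsin with rfl | rfl <;> assumption
    have hs'I : s' ∈ T₀.1 ∩ T₁.1 := by rcases hs'in with rfl | rfl <;> assumption
    have hps : p ∈ T₁.1 ↔ s ∉ T₁.1 := iff_of_false hp1 (not_not.mpr (mem_inter.mp hsI).2)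
    have hps' : p ∈ T₁.1 ↔ s' ∉ T₁.1 := iff_of_false hp1 (not_not.mpr (mem_inter.mp hs'I).2)
    have hpair : ({s, s'} : Finset G) = {q, q'} := by
      rcases hsin with rfl | rfl <;> rcases hs'in with rfl | rfl
      · exact absurd rfl hss'
      · rfl
      · exact pair_comm _ _
      · exact absurd rfl hss'
    have hX' : T₀.1 \ X.1 = {p, s, s'} := by
      rw [hX, show ({p, s, s'} : Finset G) = insert p {s, s'} from rfl, hpair]
    exact single_sub_thetaG_mem_tie_corner c hc2 hcen T₀ T₁ hbase m hn hH L hcover hm2 hp0 (mem_inter.mp hsI).1 (mem_inter.mp hs'I).1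
      hss' hps hps' X hX' hmem X (by rw [hX']) (fun _ => by rw [hX']; simp)
  · -- the cover face points to `T̄₁ = T₀·(cQ)⁻¹`: work in the frame `(T̄₁; T₀)`
    right
    rw [h1] at hs hs'
    -- frame data
    have hbaseB : ∀ Q' : G, rt c Q' (rt c c T₁) = rt c c T₁ ∨ rt c Q' (rt c c T₁) = rt c c (rt c c T₁) ∨
        rt c Q' (rt c c T₁) = T₀ ∨ rt c Q' (rt c c T₁) = rt c c T₀ :=
      base_cases_exchange c (companion_base c hc2 T₀ T₁ hbase) hB
    have hnB : (rt c c T₁).1.card = 4 * m := card_frame c hc2 T₀ (rt c c T₁) m hn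
    have hHB : ((rt c c T₁).1 \ T₀.1).card = 2 * m := by
      rw [card_sdiff_frame c hc2 T₀ (rt c c T₁)]; exact companion_card c hcen T₀ T₁ m hn hH
    have hcoverB := cover_frame c hc2 T₀ L (c * Q) hcover
    rw [hB] at hcoverB
    have hQB : rt c (c * Q)⁻¹ (rt c c T₁) = T₀ := by rw [← hB, ← rt_mul, inv_mul_cancel, rt_one]
    -- the other σ-free pair `{b, b'} = (T₀ ∩ T₁) ∖ {q, q'}`
    have hIc : (T₀.1 ∩ T₁.1).card = 2 * m := by
      have h := card_sdiff_add_card_inter T₀.1 T₁.1; rw [hn, hH] at h; omega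
    have hsub : ({q, q'} : Finset G) ⊆ T₀.1 ∩ T₁.1 := by
      intro x hx; rw [mem_insert, mem_singleton] at hx; rcases hx with rfl | rfl
      · exact hq
      · exact hq'
    have hcard2 : ((T₀.1 ∩ T₁.1) \ {q, q'}).card = 2 := by rw [card_sdiff_of_subset hsub, hIc, card_pair hqq']; omega
    obtain ⟨b, b', hbb', hbb⟩ := card_eq_two.mp hcard2
    have hb : b ∈ (T₀.1 ∩ T₁.1) \ {q, q'} := by rw [hbb]; simp
    have hb' : b' ∈ (T₀.1 ∩ T₁.1) \ {q, q'} := by rw [hbb]; simp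
    have hXB : (rt c c T₁).1 \ X.1 = {p, c * b, c * b'} := dev_compl_shapeA c hc2 hcen T₀ T₁ hp hq hq' X hX hbb
    -- shape B in the frame `(T̄₁; T₀)`
    have hpB : p ∈ (rt c c T₁).1 ∩ T₀.1 := mem_inter.mpr ⟨(mem_compl_type_iff c hcen T₁ p).mpr hp1, hp0⟩
    have hcbB : ∀ x ∈ (T₀.1 ∩ T₁.1) \ ({q, q'} : Finset G), c * x ∈ (rt c c T₁).1 \ T₀.1 := by
      intro x hx
      obtain ⟨hx0, hx1⟩ := mem_inter.mp (mem_sdiff.mp hx).1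
      refine mem_sdiff.mpr ⟨(mem_compl_type_iff c hcen T₁ _).mpr ((T₁.2 x).mp hx1), (T₀.2 x).mp hx0⟩
    have hcb := hcbB b hb
    have hcb' := hcbB b' hb'
    have hcbb' : c * b ≠ c * b' := fun h => hbb' (mul_left_cancel h)
    -- forcing in the frame `(T̄₁; T₀)`: the places of the face are `{c·b, c·b'}`
    have e2 : rt c (Q₂ * (c * Q)⁻¹) (rt c c T₁) = rt c (1 : G) (rt c c T₁) := by
      rw [← hB, ← rt_mul, inv_mul_cancel_right, rt_one, hB]; exact h1
    have hu1' : ∀ Q' : G, ddist (rt c Q' (rt c c T₁)) (oflipCM c hc2 s X) = bpot c (rt c c T₁) (oflipCM c hc2 s X) →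
        rt c Q' (rt c c T₁) = rt c (1 : G) (rt c c T₁) := by
      have h := unique_frame c T₀ (c * Q) hu1
      rw [hB] at h
      intro Q' hQ'; rw [h Q' hQ', e2]
    have hu2' : ∀ Q' : G, ddist (rt c Q' (rt c c T₁)) (oflipCM c hc2 s' X) = bpot c (rt c c T₁) (oflipCM c hc2 s' X) →
        rt c Q' (rt c c T₁) = rt c (1 : G) (rt c c T₁) := by
      have h := unique_frame c T₀ (c * Q) hu2
      rw [hB] at h
      intro Q' hQ'; rw [h Q' hQ', e2]
    have hsp : s ≠ p :=
      strict_place_ne_shapeB c hc2 hcen (rt c c T₁) T₀ hbaseB m hnB hHB hm hpB hcb hcb' hcbb' X hXB (c * Q)⁻¹ hQB hu1'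
    have hs'p : s' ≠ p :=
      strict_place_ne_shapeB c hc2 hcen (rt c c T₁) T₀ hbaseB m hnB hHB hm hpB hcb hcb' hcbb' X hXB (c * Q)⁻¹ hQB hu2'
    have hsin : s = c * b ∨ s = c * b' := by
      have h := hs; rw [hXB, mem_insert, mem_insert, mem_singleton] at h
      rcases h with h | h | h
      · exact absurd h hsp
      · exact Or.inl h
      · exact Or.inr h
    have hs'in : s' = c * b ∨ s' = c * b' := by
      have h := hs'; rw [hXB, mem_insert, mem_insert, mem_singleton] at h
      rcases h with h | h | h
      · exact absurd h hs'p
      · exact Or.inl h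
      · exact Or.inr h
    have hsD : s ∈ (rt c c T₁).1 \ T₀.1 := by rcases hsin with rfl | rfl <;> assumption
    have hs'D : s' ∈ (rt c c T₁).1 \ T₀.1 := by rcases hs'in with rfl | rfl <;> assumption
    have hps : p ∈ T₀.1 ↔ s ∉ T₀.1 := iff_of_true hp0 (mem_sdiff.mp hsD).2
    have hps' : p ∈ T₀.1 ↔ s' ∉ T₀.1 := iff_of_true hp0 (mem_sdiff.mp hs'D).2
    have hpair : ({s, s'} : Finset G) = {c * b, c * b'} := by
      rcases hsin with rfl | rfl <;> rcases hs'in with rfl | rfl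
      · exact absurd rfl hss'
      · rfl
      · exact pair_comm _ _
      · exact absurd rfl hss'
    have hXB' : (rt c c T₁).1 \ X.1 = {p, s, s'} := by
      rw [hXB, show ({p, s, s'} : Finset G) = insert p {s, s'} from rfl, hpair]
    exact single_sub_thetaG_mem_tie_corner c hc2 hcen (rt c c T₁) T₀ hbaseB m hnB hHB L hcoverB hm2 (mem_inter.mp hpB).1
      (mem_sdiff.mp hsD).1 (mem_sdiff.mp hs'D).1 hss' hps hps' X hXB' hmem X (by rw [hXB']) (fun _ => by rw [hXB']; simp)

include hcen hbase hn hH hQ hcover in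
/-- **TIE CORNER DICHOTOMY, shape B, `m = 2`.**  For the corner `X = ⟨p, q, q'⟩` (`p ∈ T₀ ∩ T₁`, `q ≠ q' ∈ 𝓗`): `[X] − θ_{T₀}(typeSum [X]) ∈ L` or
`[X] − θ_{T₁}(typeSum [X]) ∈ L`, for every strict lowering cover feeding `L`. [folklore] -/
theorem tie_corner_dichotomy_shapeB (hm : m = 2) {p q q' : G} (hp : p ∈ T₀.1 ∩ T₁.1) (hq : q ∈ T₀.1 \ T₁.1)
    (hq' : q' ∈ T₀.1 \ T₁.1) (hqq' : q ≠ q') (X : CMF G c) (hX : T₀.1 \ X.1 = {p, q, q'}) :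
    Finsupp.single X 1 - thetaG c hc2 T₀ (typeSum G c (Finsupp.single X 1)) ∈ L ∨
      Finsupp.single X 1 - thetaG c hc2 T₁ (typeSum G c (Finsupp.single X 1)) ∈ L := by
  have hm2 : 2 ≤ m := by omega
  have hp0 : p ∈ T₀.1 := (mem_inter.mp hp).1
  have hp1 : p ∈ T₁.1 := (mem_inter.mp hp).2
  have hq0 : q ∈ T₀.1 := (mem_sdiff.mp hq).1
  have hq0' : q' ∈ T₀.1 := (mem_sdiff.mp hq').1
  have hpq : p ∈ T₁.1 ↔ q ∉ T₁.1 := iff_of_true hp1 (mem_sdiff.mp hq).2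
  have hpq' : p ∈ T₁.1 ↔ q' ∉ T₁.1 := iff_of_true hp1 (mem_sdiff.mp hq').2
  obtain ⟨hbp, hnear⟩ := nearest_shapeB c hc2 hcen T₀ T₁ hbase m hn hH hm2 hp hq hq' hqq' X hX
  obtain ⟨k0, kq, kq', -, ku1, ku2, ku3⟩ :=
    strict_triple_tie_corner c hc2 hcen T₀ T₁ hbase m hn hH hm2 hp0 hq0 hq0' hqq' hpq hpq' X hX hbp
  obtain ⟨Q₂, s, s', hQ₂, hs, hs', hss', hmem, hstr⟩ := hcover X (by rw [hbp]; omega)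
  obtain ⟨hu1, hu2, -⟩ := hstr ⟨1, q, q', k0, kq, kq', hqq', ku1, ku2, ku3⟩
  rcases hnear Q₂ hQ₂.symm with h0 | h1
  · -- toward `T₀`
    left
    rw [h0] at hs hs' hu1 hu2
    have hu1' : ∀ Q' : G, ddist (rt c Q' T₀) (oflipCM c hc2 s X) = bpot c T₀ (oflipCM c hc2 s X) → rt c Q' T₀ = rt c (1 : G) T₀ :=
      fun Q' h => by rw [rt_one]; exact hu1 Q' h
    have hu2' : ∀ Q' : G, ddist (rt c Q' T₀) (oflipCM c hc2 s' X) = bpot c T₀ (oflipCM c hc2 s' X) → rt c Q' T₀ = rt c (1 : G) T₀ :=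
      fun Q' h => by rw [rt_one]; exact hu2 Q' h
    have hsp : s ≠ p := strict_place_ne_shapeB c hc2 hcen T₀ T₁ hbase m hn hH hm hp hq hq' hqq' X hX Q hQ hu1'
    have hs'p : s' ≠ p := strict_place_ne_shapeB c hc2 hcen T₀ T₁ hbase m hn hH hm hp hq hq' hqq' X hX Q hQ hu2'
    have hsin : s = q ∨ s = q' := by
      have h := hs; rw [hX, mem_insert, mem_insert, mem_singleton] at h
      rcases h with h | h | h
      · exact absurd h hsp
      · exact Or.inl h
      · exact Or.inr h
    have hs'in : s' = q ∨ s' = q' := by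
      have h := hs'; rw [hX, mem_insert, mem_insert, mem_singleton] at h
      rcases h with h | h | h
      · exact absurd h hs'p
      · exact Or.inl h
      · exact Or.inr h
    have hsH : s ∈ T₀.1 \ T₁.1 := by rcases hsin with rfl | rfl <;> assumption
    have hs'H : s' ∈ T₀.1 \ T₁.1 := by rcases hs'in with rfl | rfl <;> assumption
    have hps : p ∈ T₁.1 ↔ s ∉ T₁.1 := iff_of_true hp1 (mem_sdiff.mp hsH).2
    have hps' : p ∈ T₁.1 ↔ s' ∉ T₁.1 := iff_of_true hp1 (mem_sdiff.mp hs'H).2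
    have hpair : ({s, s'} : Finset G) = {q, q'} := by
      rcases hsin with rfl | rfl <;> rcases hs'in with rfl | rfl
      · exact absurd rfl hss'
      · rfl
      · exact pair_comm _ _
      · exact absurd rfl hss'
    have hX' : T₀.1 \ X.1 = {p, s, s'} := by
      rw [hX, show ({p, s, s'} : Finset G) = insert p {s, s'} from rfl, hpair]
    exact single_sub_thetaG_mem_tie_corner c hc2 hcen T₀ T₁ hbase m hn hH L hcover hm2 hp0 (mem_sdiff.mp hsH).1 (mem_sdiff.mp hs'H).1
      hss' hps hps' X hX' hmem X (by rw [hX']) (fun _ => by rw [hX']; simp)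
  · -- toward `T₁ = T₀·Q⁻¹`: work in the frame `(T₁; T₀)`
    right
    rw [h1] at hs hs'
    have hbase1 : ∀ Q' : G, rt c Q' T₁ = T₁ ∨ rt c Q' T₁ = rt c c T₁ ∨ rt c Q' T₁ = T₀ ∨ rt c Q' T₁ = rt c c T₀ :=
      base_cases_exchange c hbase hQ
    have hn1 : T₁.1.card = 4 * m := card_frame c hc2 T₀ T₁ m hn
    have hH1 : (T₁.1 \ T₀.1).card = 2 * m := by rw [card_sdiff_frame c hc2 T₀ T₁]; exact hH
    have hcover1 := cover_frame c hc2 T₀ L Q hcover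
    rw [hQ] at hcover1
    have hQ1 : rt c Q⁻¹ T₁ = T₀ := by rw [← hQ, ← rt_mul, inv_mul_cancel, rt_one]
    -- `{h, h'} = 𝓗 ∖ {q, q'}`
    have hsub : ({q, q'} : Finset G) ⊆ T₀.1 \ T₁.1 := by
      intro x hx; rw [mem_insert, mem_singleton] at hx; rcases hx with rfl | rfl
      · exact hq
      · exact hq'
    have hcard2 : ((T₀.1 \ T₁.1) \ {q, q'}).card = 2 := by rw [card_sdiff_of_subset hsub, hH, card_pair hqq']; omega
    obtain ⟨h, h', hhh', hhh⟩ := card_eq_two.mp hcard2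
    have hh : h ∈ (T₀.1 \ T₁.1) \ {q, q'} := by rw [hhh]; simp
    have hh' : h' ∈ (T₀.1 \ T₁.1) \ {q, q'} := by rw [hhh]; simp
    have hX1 : T₁.1 \ X.1 = {p, c * h, c * h'} := dev_frame_shapeB c hc2 T₀ T₁ hp hq hq' X hX hhh
    have hp1' : p ∈ T₁.1 ∩ T₀.1 := mem_inter.mpr ⟨hp1, hp0⟩
    have hch1 : ∀ x ∈ (T₀.1 \ T₁.1) \ ({q, q'} : Finset G), c * x ∈ T₁.1 \ T₀.1 := by
      intro x hx
      obtain ⟨hx0, hx1⟩ := mem_sdiff.mp (mem_sdiff.mp hx).1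
      refine mem_sdiff.mpr ⟨?_, (T₀.2 x).mp hx0⟩
      by_contra hcx; exact hx1 ((T₁.2 x).mpr hcx)
    have hch := hch1 h hh
    have hch' := hch1 h' hh'
    have hchh' : c * h ≠ c * h' := fun e => hhh' (mul_left_cancel e)
    have e2 : rt c (Q₂ * Q⁻¹) T₁ = rt c (1 : G) T₁ := by
      rw [← hQ, ← rt_mul, inv_mul_cancel_right, rt_one, hQ]; exact h1
    have hu1' : ∀ Q' : G, ddist (rt c Q' T₁) (oflipCM c hc2 s X) = bpot c T₁ (oflipCM c hc2 s X) → rt c Q' T₁ = rt c (1 : G) T₁ := by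
      have k := unique_frame c T₀ Q hu1
      rw [hQ] at k
      intro Q' hQ'; rw [k Q' hQ', e2]
    have hu2' : ∀ Q' : G, ddist (rt c Q' T₁) (oflipCM c hc2 s' X) = bpot c T₁ (oflipCM c hc2 s' X) → rt c Q' T₁ = rt c (1 : G) T₁ := by
      have k := unique_frame c T₀ Q hu2
      rw [hQ] at k
      intro Q' hQ'; rw [k Q' hQ', e2]
    have hsp : s ≠ p :=
      strict_place_ne_shapeB c hc2 hcen T₁ T₀ hbase1 m hn1 hH1 hm hp1' hch hch' hchh' X hX1 Q⁻¹ hQ1 hu1'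
    have hs'p : s' ≠ p :=
      strict_place_ne_shapeB c hc2 hcen T₁ T₀ hbase1 m hn1 hH1 hm hp1' hch hch' hchh' X hX1 Q⁻¹ hQ1 hu2'
    have hsin : s = c * h ∨ s = c * h' := by
      have k := hs; rw [hX1, mem_insert, mem_insert, mem_singleton] at k
      rcases k with k | k | k
      · exact absurd k hsp
      · exact Or.inl k
      · exact Or.inr k
    have hs'in : s' = c * h ∨ s' = c * h' := by
      have k := hs'; rw [hX1, mem_insert, mem_insert, mem_singleton] at k
      rcases k with k | k | k
      · exact absurd k hs'p
      · exact Or.inl k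
      · exact Or.inr k
    have hsD : s ∈ T₁.1 \ T₀.1 := by rcases hsin with rfl | rfl <;> assumption
    have hs'D : s' ∈ T₁.1 \ T₀.1 := by rcases hs'in with rfl | rfl <;> assumption
    have hps : p ∈ T₀.1 ↔ s ∉ T₀.1 := iff_of_true hp0 (mem_sdiff.mp hsD).2
    have hps' : p ∈ T₀.1 ↔ s' ∉ T₀.1 := iff_of_true hp0 (mem_sdiff.mp hs'D).2
    have hpair : ({s, s'} : Finset G) = {c * h, c * h'} := by
      rcases hsin with rfl | rfl <;> rcases hs'in with rfl | rfl
      · exact absurd rfl hss'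
      · rfl
      · exact pair_comm _ _
      · exact absurd rfl hss'
    have hX1' : T₁.1 \ X.1 = {p, s, s'} := by
      rw [hX1, show ({p, s, s'} : Finset G) = insert p {s, s'} from rfl, hpair]
    exact single_sub_thetaG_mem_tie_corner c hc2 hcen T₁ T₀ hbase1 m hn1 hH1 L hcover1 hm2 hp1 (mem_sdiff.mp hsD).1
      (mem_sdiff.mp hs'D).1 hss' hps hps' X hX1' hmem X (by rw [hX1']) (fun _ => by rw [hX1']; simp)

end Frame

end

end Summit.HodgeConjecture.CorCM.Census.CentralSquares
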